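import Summits.CriticalPhenomena.PercolationContinuityZ3.Theorems.PercNearOneGluingNoHeavyLowerTailThreePointGammaEdgePolarPrelim
import HarnessLib

/-!
# `NoHeavyLowerTail` (stmt-CriticalPhenomena-4575) — the EDGE POLAR FORM of `Γ` is nonnegative on every edge, II:
# the two pointwise lemmas and the theorem (`S01 ≥ 0` / `B_e ≥ 0`: single-coordinate Bernstein positivity of the Aas–Gladkov defect row `Γ`)

Support file (prover prim-ineq-gen-2 gen 5; `--supports stmt-CriticalPhenomena-4575`).  No named facts, no sorries.

`Γ(D,p) = q t − u_a u_b − u_a u_c − u_b u_c − u_a (n_a + n′_a) ≥ 0` on every finite weighted graph is `ThreePointGamma.gamma_PrW`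
(prim-lit-2 PROOF-GAMMA, formalised by prim-cert-2).  Along one coordinate `e ∈ D` (support KEPT, `p⁰ = p[e ↦ 0]`, `p¹ = p[e ↦ 1]`)
`p_e ↦ Γ(D,p)` is quadratic: `Γ(D,p) = (1−p_e)² Γ(D,p⁰) + p_e(1−p_e)·S01_e + p_e² Γ(D,p¹)`, where `S01_e = 2 B_e` is the polar form of the
quadratic form `Γ` between the two section laws of `e` (ttrl2 census `hms`, lines 398/469: `S01 ≥ 0` on all 606.8 M exact edge-steps of all
weighted graphs with `≤ 8` vertices and on 8 439 adversarial climbs with `≤ 12` vertices — for EVERY edge type).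

**Theorem** (`gamP_edge_polar`, this file): `(1 − p_e)²·Γ(D,p⁰) + p_e²·Γ(D,p¹) ≤ Γ(D,p)` for every `e ∈ D`, i.e. `S01_e ≥ 0`;
hence `Γ ≥ 0` is inductive along ANY edge order and `Γ(D,p) ≥ Σ_ξ w(ξ)² Γ(D,p^ξ)` over the states `ξ` of any edge set.

Proof (prim-ineq-gen-2 S01-THEOREM.md).  PROOF-GAMMA writes `Γ = Σ_x wt3W(x)·F(x)` over triples `x = (X,Y,Z)`, `F = −gcert ∈ {0,1}`.
Splitting along `e` (`DTree3.sum_triples_split`), `Γ(D,p) − (1−p_e)²Γ⁰⁰ − p_e²Γ¹¹ = p_e(1−p_e) Σ_y w′(y)[(1−p_e)(Σ₁ − F₀₀₀) + p_e(Σ₂ − F₁₁₁)]`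
with `Σ₁ = F₁₀₀+F₀₁₀+F₀₀₁`, `Σ₂ = F₀₁₁+F₁₀₁+F₁₁₀` (bits = `e` open in `X,Y,Z`), and the two POINTWISE lemmas `gcert_P0` (`F₀₀₀ ≤ Σ₁`) and
`gcert_P1` (`F₁₁₁ ≤ Σ₂`) hold by a four-case analysis on whether `e` meets `A = cl X a` and/or `B = cl X b`: in three cases one of the
three single-copy flips of `e` is read by NO output of `Φ₃, Φ₄` (outputs unchanged), and in the case `e ∈ touch A ∩ touch B` flipping `e` in
`Z` only enlarges the output `o₃` of `Φ₃`, in which the potential `λ₃` is monotone (`gq_insert_le`); for `P1` that case forces `a ~_X b`, where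
the certificate vanishes.
-/

noncomputable section

namespace Summit.CriticalPhenomena.PercolationContinuityZ3.Theorems

namespace ThreePointGamma

open Finset Literature.Probability.Percolation Literature.Probability.Percolation.DecisionTree
open Literature.Probability.Percolation.Gladkov ThreePointLB
open scoped Classical

variable {V : Type*} [Fintype V] [DecidableEq V]

/-! ### The two pointwise lemmas -/

section Pointwise

variable (D : Finset (Sym2 V)) (a b c : V)

/-- **(P0)** With `e` closed in all three copies, the certificate event survives opening `e` in SOME single copy:
`F(X,Y,Z) ≤ F(X+e,Y,Z) + F(X,Y+e,Z) + F(X,Y,Z+e)` for `F = −gcert ∈ {0,1}`.  Four cases on whether `e` meets `cl X a`, `cl X b`. [this work] -/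
theorem gcert_P0 {X Y Z : Finset (Sym2 V)} (hX : X ⊆ D) {e : Sym2 V} (he : e ∈ D) :
    - gcert D a b c ![X, Y, Z] ≤
      - gcert D a b c ![insert e X, Y, Z] - gcert D a b c ![X, insert e Y, Z] - gcert D a b c ![X, Y, insert e Z] := by
  have g0 := gcert_nonpos D a b c ![insert e X, Y, Z] (by simpa using Finset.insert_subset he hX)
  have g1 := gcert_nonpos D a b c ![X, insert e Y, Z] (by simpa using hX)
  have g2 := gcert_nonpos D a b c ![X, Y, insert e Z] (by simpa using hX)
  by_cases hA : e ∈ touch (cl X a) <;> by_cases hB : e ∈ touch (cl X b)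
  · -- `e` meets both clusters: opening `e` in `Z` enlarges `o₃` only
    have h : gcert D a b c ![X, Y, insert e Z] ≤ gcert D a b c ![X, Y, Z] := by
      have hnot : e ∉ touch (cl X b) \ touch (cl X a) := fun h => (Finset.mem_sdiff.1 h).2 hA
      simp only [gcert_eq_gq, phi3_one_vec, phi3_two_vec, phi4_one_vec, phi4_two_vec, splice_insert_right_of_not_mem hnot,
        splice_insert_right_of_mem hB]
      exact gq_insert_le _ _ _ _ _
    linarith
  · -- `e` meets `cl X a` only: `Y_e` is read by no output
    have h : gcert D a b c ![X, insert e Y, Z] = gcert D a b c ![X, Y, Z] := by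
      simp only [gcert_eq_gq, phi3_one_vec, phi3_two_vec, phi4_one_vec, phi4_two_vec, splice_insert_right_of_mem hA,
        splice_insert_right_of_mem (Finset.mem_sdiff.2 ⟨hA, hB⟩)]
    linarith
  · -- `e` meets `cl X b` only: `Z_e` is read by no output
    have h : gcert D a b c ![X, Y, insert e Z] = gcert D a b c ![X, Y, Z] := by
      simp only [gcert_eq_gq, phi3_one_vec, phi3_two_vec, phi4_one_vec, phi4_two_vec, splice_insert_right_of_mem hB,
        splice_insert_right_of_mem (Finset.mem_sdiff.2 ⟨hB, hA⟩)]
    linarith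
  · -- `e` meets neither cluster: `X_e` changes neither cluster nor any output
    have hca : cl (insert e X) a = cl X a := cl_insert_of_not_mem_touch hA
    have hcb : cl (insert e X) b = cl X b := cl_insert_of_not_mem_touch hB
    have hA' : e ∉ touch (cl X a) \ touch (cl X b) := fun h => hA (Finset.mem_sdiff.1 h).1
    have hB' : e ∉ touch (cl X b) \ touch (cl X a) := fun h => hB (Finset.mem_sdiff.1 h).1
    have h : gcert D a b c ![insert e X, Y, Z] = gcert D a b c ![X, Y, Z] := by
      simp only [gcert_eq_gq, phi3_one_vec, phi3_two_vec, phi4_one_vec, phi4_two_vec, hca, hcb, splice_insert_left_of_not_mem hA,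
        splice_insert_left_of_not_mem hB, splice_insert_left_of_not_mem hA', splice_insert_left_of_not_mem hB']
    linarith

/-- **(P1)** With `e` open in all three copies, the certificate event survives closing `e` in SOME single copy:
`F(X+e,Y+e,Z+e) ≤ F(X,Y+e,Z+e) + F(X+e,Y,Z+e) + F(X+e,Y+e,Z)`.  Four cases on whether `e` meets `cl (X+e) a`, `cl (X+e) b`;
when it meets both, `a ~ b` in `X+e` and the certificate vanishes. [this work] -/
theorem gcert_P1 {X Y Z : Finset (Sym2 V)} (hX : X ⊆ D) {e : Sym2 V} (he : e ∈ D) :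
    - gcert D a b c ![insert e X, insert e Y, insert e Z] ≤
      - gcert D a b c ![X, insert e Y, insert e Z] - gcert D a b c ![insert e X, Y, insert e Z]
        - gcert D a b c ![insert e X, insert e Y, Z] := by
  have hXe : insert e X ⊆ D := Finset.insert_subset he hX
  have g0 := gcert_nonpos D a b c ![X, insert e Y, insert e Z] (by simpa using hX)
  have g1 := gcert_nonpos D a b c ![insert e X, Y, insert e Z] (by simpa using hXe)
  have g2 := gcert_nonpos D a b c ![insert e X, insert e Y, Z] (by simpa using hXe)
  by_cases hA : e ∈ touch (cl (insert e X) a) <;> by_cases hB : e ∈ touch (cl (insert e X) b)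
  · -- `e` meets both clusters of `X+e`: they coincide, `a ~ b`, and the certificate is `0`
    have hab : b ∈ cl (insert e X) a := mem_cl_of_mem_touch_touch (Finset.mem_insert_self e X) hA hB
    have h : 0 ≤ gcert D a b c ![insert e X, insert e Y, insert e Z] := by
      rw [gcert_eq_gq, phi3_one_vec]
      exact gq_nonneg_of_conn (mem_conn_iff_mem_cl.2 ((mem_cl_splice_touch_iff_of_mem (mem_cl_self (insert e X) a) b).2 hab))
    linarith
  · -- `e` meets `cl (X+e) a` only: `Y_e` is read by no output
    have h : gcert D a b c ![insert e X, Y, insert e Z] = gcert D a b c ![insert e X, insert e Y, insert e Z] := by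
      simp only [gcert_eq_gq, phi3_one_vec, phi3_two_vec, phi4_one_vec, phi4_two_vec, splice_insert_right_of_mem hA,
        splice_insert_right_of_mem (Finset.mem_sdiff.2 ⟨hA, hB⟩)]
    linarith
  · -- `e` meets `cl (X+e) b` only: `Z_e` is read by no output
    have h : gcert D a b c ![insert e X, insert e Y, Z] = gcert D a b c ![insert e X, insert e Y, insert e Z] := by
      simp only [gcert_eq_gq, phi3_one_vec, phi3_two_vec, phi4_one_vec, phi4_two_vec, splice_insert_right_of_mem hB,
        splice_insert_right_of_mem (Finset.mem_sdiff.2 ⟨hB, hA⟩)]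
    linarith
  · -- `e` meets neither cluster: removing it from `X` changes neither cluster nor any output
    have hca : cl X a = cl (insert e X) a := cl_eq_cl_insert_of_not_mem_touch hA
    have hcb : cl X b = cl (insert e X) b := cl_eq_cl_insert_of_not_mem_touch hB
    have hA' : e ∉ touch (cl (insert e X) a) \ touch (cl (insert e X) b) := fun h => hA (Finset.mem_sdiff.1 h).1
    have hB' : e ∉ touch (cl (insert e X) b) \ touch (cl (insert e X) a) := fun h => hB (Finset.mem_sdiff.1 h).1
    have h : gcert D a b c ![X, insert e Y, insert e Z] = gcert D a b c ![insert e X, insert e Y, insert e Z] := by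
      simp only [gcert_eq_gq, phi3_one_vec, phi3_two_vec, phi4_one_vec, phi4_two_vec, hca, hcb, splice_insert_left_of_not_mem hA,
        splice_insert_left_of_not_mem hB, splice_insert_left_of_not_mem hA', splice_insert_left_of_not_mem hB']
    linarith

end Pointwise

/-! ### The theorem -/

section Main

variable {p : Sym2 V → ℝ} (hp0 : ∀ i, 0 ≤ p i) (hp1 : ∀ i, p i ≤ 1) (D : Finset (Sym2 V)) (a b c : V)
include hp0 hp1

/-- **The edge polar form of `Γ` is nonnegative** (`S01 ≥ 0`, `B_e ≥ 0`; prim-ineq-gen-2, census ttrl2 `hms` lines 398/469): for every support `D`,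
probabilities `p ∈ [0,1]`, coordinate `e ∈ D` and all `a b c`,
  `(1 − p_e)² · Γ(D, p[e↦0]) + p_e² · Γ(D, p[e↦1]) ≤ Γ(D, p)`,
i.e. the middle Bernstein coefficient `S01_e/2` of the quadratic `p_e ↦ Γ(D,p)` is `≥ 0` (the outer ones are `Γ`'s of the two sections,
`≥ 0` by `gamma_PrW`).  Consequently `Γ ≥ 0` is inductive along any edge, and `Γ(D,p) ≥ Σ_ξ w(ξ)² Γ(D,p^ξ)` over the states of any edge set. [this work] -/
theorem gamP_edge_polar {e : Sym2 V} (he : e ∈ D) :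
    (1 - p e) ^ 2 * GamP D (Function.update p e 0) a b c + p e ^ 2 * GamP D (Function.update p e 1) a b c ≤ GamP D p a b c := by
  rw [GamP_eq_sum, GamP_eq_sum, GamP_eq_sum, sum_triples_split8 D _ he, sum_triples_split8 D _ he, sum_triples_split8 D p he]
  simp only [wt3W_erase_update, Function.update_self]
  rw [Finset.mul_sum, Finset.mul_sum, ← Finset.sum_add_distrib]
  refine Finset.sum_le_sum fun y hy => ?_
  have hy0 : y 0 ⊆ D := (mem_triples.1 hy 0).trans (Finset.erase_subset e D)
  have hw : 0 ≤ wt3W (D.erase e) p y := DTree3.wt3W_nonneg (D.erase e) hp0 hp1 y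
  -- the eight values of `F = −gcert` at `y` with the bits of `e`
  have hP0 := gcert_P0 D a b c (Y := y 1) (Z := y 2) hy0 he
  have hP1 := gcert_P1 D a b c (Y := y 1) (Z := y 2) hy0 he
  have hXe : insert e (y 0) ⊆ D := Finset.insert_subset he hy0
  have f000 := gcert_nonpos D a b c ![y 0, y 1, y 2] (by simpa using hy0)
  have f111 := gcert_nonpos D a b c ![insert e (y 0), insert e (y 1), insert e (y 2)] (by simpa using hXe)
  have f100 := gcert_nonpos D a b c ![insert e (y 0), y 1, y 2] (by simpa using hXe)
  have f010 := gcert_nonpos D a b c ![y 0, insert e (y 1), y 2] (by simpa using hy0)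
  have f001 := gcert_nonpos D a b c ![y 0, y 1, insert e (y 2)] (by simpa using hy0)
  have f011 := gcert_nonpos D a b c ![y 0, insert e (y 1), insert e (y 2)] (by simpa using hy0)
  have f101 := gcert_nonpos D a b c ![insert e (y 0), y 1, insert e (y 2)] (by simpa using hXe)
  have f110 := gcert_nonpos D a b c ![insert e (y 0), insert e (y 1), y 2] (by simpa using hXe)
  have hs : 0 ≤ p e := hp0 e
  have hs1 : 0 ≤ 1 - p e := sub_nonneg.2 (hp1 e)
  have key : (1 - p e) ^ 2 * bern8 0 (fun x => - gcert D a b c x) e y + p e ^ 2 * bern8 1 (fun x => - gcert D a b c x) e y ≤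
      bern8 (p e) (fun x => - gcert D a b c x) e y := by
    simp only [bern8]
    nlinarith [mul_nonneg (mul_nonneg (mul_nonneg hs1 hs1) hs) (sub_nonneg.2 hP0), mul_nonneg (mul_nonneg (mul_nonneg hs1 hs) hs) (sub_nonneg.2 hP1)]
  have := mul_le_mul_of_nonneg_left key hw
  nlinarith [this]

/-- The same with the sections named: `(1−p_e)²·Γ⁰⁰ + p_e²·Γ¹¹ ≤ Γ`, and both sections are themselves `≥ 0`. [this work] -/
theorem gamP_sections_nonneg {e : Sym2 V} (he : e ∈ D) :
    0 ≤ GamP D (Function.update p e 0) a b c ∧ 0 ≤ GamP D (Function.update p e 1) a b c ∧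
      (1 - p e) ^ 2 * GamP D (Function.update p e 0) a b c + p e ^ 2 * GamP D (Function.update p e 1) a b c ≤ GamP D p a b c := by
  refine ⟨gamP_nonneg D a b c ?_ ?_, gamP_nonneg D a b c ?_ ?_, gamP_edge_polar hp0 hp1 D a b c he⟩
  · intro i; by_cases hi : i = e
    · subst hi; simp
    · rw [Function.update_of_ne hi]; exact hp0 i
  · intro i; by_cases hi : i = e
    · subst hi; simp
    · rw [Function.update_of_ne hi]; exact hp1 i
  · intro i; by_cases hi : i = e
    · subst hi; simp
    · rw [Function.update_of_ne hi]; exact hp0 i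
  · intro i; by_cases hi : i = e
    · subst hi; simp
    · rw [Function.update_of_ne hi]; exact hp1 i

end Main


end ThreePointGamma

end Summit.CriticalPhenomena.PercolationContinuityZ3.Theorems

end
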